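import Literature.AlgebraicGeometry.ShimuraVarieties.KudlaRapoport2013.Sec14TraceDualHolds
import Mathlib.NumberTheory.NumberField.Units.Basic
import HarnessLib

/-!
# [KudlaRapoport2013, (3.1) (arXiv v2 p. 16)] «`C(k) ≅ 𝓛_{(1,0)}(k)`, `[𝔞] ↦ [L_{0,𝔞}]`» — DISCHARGED:
# `KR2013_3_eq_3_1_holds`

Kernel-lane companion of the statement carpet ★
`Literature/AlgebraicGeometry/ShimuraVarieties/KudlaRapoport2013/Sec3ComplexUniformization.lean` (squad TKR): its CLOSED
named fact ★ `KR2013_3_eq_3_1` — S. Kudla, M. Rapoport, *Special cycles on unitary Shimura varieties II: global theory*,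
J. reine angew. Math. 697 (2014) 91–157 = arXiv:0912.3758v2, §3.2 (3.1) p. 16: «Consider the special case `n = 1` and
`r = 0`. A fractional ideal `𝔞` defines a self-dual hermitian lattice `L_{0,𝔞}` in the space `V_{0,𝔞} = k` with hermitian form
`(x, y) = N(𝔞)⁻¹ x y^σ`. This gives an isomorphism `C(k) ≅ 𝓛_{(1,0)}(k)`, `[𝔞] ↦ [L_{0,𝔞}]`» — typed as three clauses
((i) `L_{0,𝔞}` is a self-dual hermitian lattice of signature `(1,0)`; (ii) `L_{0,𝔞} ≅ L_{0,𝔟} ⟺ [𝔞] = [𝔟]`; (iii) every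
self-dual hermitian `O_k`-lattice of rank `1` and signature `(1,0)` is isomorphic to some `L_{0,𝔞}`) — is PROVED here.
THEOREMS ONLY (no definition, no named fact, no `sorry`, no instance, no notation); cell hodgecm-mathlib, seat B-typ03
(g34); net debt −1.  HONEST LABEL: HC_CM is proved only modulo the 7 printed citations (2 remaining named inputs: hLiu418,
h413) until rung 0 closes; this file is off that cone and adds no citation debt.

## The proof

KR give no proof («This gives an isomorphism»); the arithmetic is the quadratic-field identity `𝔞 · σ(𝔞) = N(𝔞) O_k`
(Neukirch I (2.6) (iii)), in the two elementwise forms ★ `KR14dual.exists_int_eq_absNorm_inv_mul` («(P1)»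
`N(𝔞)⁻¹ σ(x) y ∈ O_k` for `x, y ∈ 𝔞`) and ★ `KR14dual.absNorm_mul_conj_mem` («(P2)» `N(𝔞) σ(y) ∈ 𝔞` for `y ∈ 𝔞⁻¹`) of
★ `Sec14TraceDualHolds` (B-typ01 (g32), ED. 2).
* (i) `idealLatticeDatum_isSelfDualHermLattice`: hermitian since `N(𝔞)⁻¹ ∈ ℚ`; signature `(1,0)` with `T = (√N(𝔞))`;
  full since `𝔞` is finitely generated and non-zero; self-dual: `⊆` is (P1), and if `N(𝔞)⁻¹ x σ(y) ∈ O_k` for all `y ∈ 𝔞`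
  then `x y' ∈ O_k` for all `y' ∈ 𝔞⁻¹` (take `y = N(𝔞) σ(y')`, (P2)), i.e. `x ∈ (𝔞⁻¹)⁻¹ = 𝔞`.
* (ii) `exists_moves_idealLatticeDatum_iff`: an isomorphism `g = (c)` carries `L_{0,𝔞}` onto `L_{0,𝔟}` iff `𝔟 = c𝔞`, i.e.
  iff `𝔞⁻¹𝔟` is principal (Mathlib `ClassGroup.mk_eq_one_iff`); the form condition `σ(c) N(𝔟)⁻¹ c = N(𝔞)⁻¹` is automatic
  from `N(c𝔞) = |N(c)| N(𝔞)` (`FractionalIdeal.absNorm_span_singleton`) and `N(c) = c σ(c) > 0` (imaginary quadratic).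
* (iii) `exists_moves_idealLatticeDatum_of_isSelfDualHermLattice`: a full `O_k`-lattice `L ⊆ k` is a fractional ideal
  `𝔞`; self-duality of `(j, L)` against (i) gives `x ∈ 𝔞 ⟺ jN(𝔞)·x ∈ 𝔞`, so `(jN(𝔞)) 𝔞 = 𝔞` and `u = jN(𝔞)` is a unit of
  `O_k`; its norm `u σ(u) = ±1` has `τ`-image `|τ u|²`, while the signature makes `τ(u) = τ(j) N(𝔞)` a positive real; hence
  `τ(u) = 1`, `u = 1`, `j = N(𝔞)⁻¹` and `(j, L) = L_{0,𝔞}` on the nose (`g = 1`).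

## References
* [KudlaRapoport2013] S. Kudla, M. Rapoport, *Special cycles on unitary Shimura varieties II: global theory*, J. reine
  angew. Math. 697 (2014) 91–157; arXiv:0912.3758v2, §3.2 (3.1) (p. 16).
* [NeukirchANT1999] J. Neukirch, *Algebraic Number Theory*, Ch. I §2 Prop. (2.6) (`𝔞 σ(𝔞) = (N𝔞)`), Ch. I §6 (the ideal
  class group as fractional ideals modulo principal ones).
-/

set_option autoImplicit false

noncomputable section

open NumberField Matrix
open scoped nonZeroDivisors ComplexOrder

namespace Literature.AlgebraicGeometry.ShimuraVarieties.KudlaRapoport2013.Sec3ComplexUniformization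

open Literature.NumberTheory.Automorphic (formCongr)
open Literature.NumberTheory.Automorphic.Liu2021.AppendixC (conj conj_apply)
open Literature.AlgebraicGeometry.ShimuraVarieties.KudlaRapoport2013.Sec14CaseNTwo

variable {k : Type} [Field k] [NumberField k] [IsTotallyComplex k] [Algebra.IsQuadraticExtension ℚ k]

/-! ### Rank-one bookkeeping -/

omit [NumberField k] [IsTotallyComplex k] [Algebra.IsQuadraticExtension ℚ k] in
/-- The pairing in rank one: `(u, v) = σ(v₀) · J₀₀ · u₀`. [folklore] -/
private theorem krForm_fin_one (σ : k →+* k) (J : Matrix (Fin 1) (Fin 1) k) (u v : Fin 1 → k) :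
    krForm σ J u v = σ (v 0) * (J 0 0 * u 0) := by
  simp [krForm, dotProduct, mulVec]

omit [IsTotallyComplex k] [Algebra.IsQuadraticExtension ℚ k] in
/-- `x ∈ L_{0,𝔞} ⟺ x₀ ∈ 𝔞`. [folklore] -/
private theorem mem_idealLattice_iff (𝔞 : (FractionalIdeal (𝓞 k)⁰ k)ˣ) (x : Fin 1 → k) :
    x ∈ idealLattice 𝔞 ↔ x 0 ∈ (𝔞 : FractionalIdeal (𝓞 k)⁰ k) := by
  rw [idealLattice, Submodule.mem_map_equiv, LinearEquiv.symm_symm, LinearEquiv.funUnique_apply,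
    Fin.default_eq_zero, FractionalIdeal.mem_coe]

omit [IsTotallyComplex k] [Algebra.IsQuadraticExtension ℚ k] in
/-- The constant vector `(a)` lies in `L_{0,𝔞}` iff `a ∈ 𝔞`. [folklore] -/
private theorem const_mem_idealLattice_iff (𝔞 : (FractionalIdeal (𝓞 k)⁰ k)ˣ) (a : k) :
    (fun _ : Fin 1 => a) ∈ idealLattice 𝔞 ↔ a ∈ (𝔞 : FractionalIdeal (𝓞 k)⁰ k) :=
  mem_idealLattice_iff 𝔞 _

/-- `σ² = 1`. [folklore] -/
private theorem conj_conj' (x : k) : conj ℚ k (conj ℚ k x) = x := by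
  letI : IsCMField k := IsCMField.ofCMExtension ℚ k
  rw [conj_apply, conj_apply]
  exact IsCMField.complexConj_apply_apply (K := k) x

/-- `τ(σ x) = conj(τ x)` for every complex embedding `τ`. [folklore] -/
private theorem embedding_conj (τ : k →+* ℂ) (x : k) : τ (conj ℚ k x) = starRingEnd ℂ (τ x) := by
  letI : IsCMField k := IsCMField.ofCMExtension ℚ k
  rw [conj_apply]
  exact IsCMField.complexEmbedding_complexConj (K := k) τ x

omit [IsTotallyComplex k] [Algebra.IsQuadraticExtension ℚ k] in
/-- `τ(q) = q` for rationals. [folklore] -/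
private theorem embedding_algebraMap (τ : k →+* ℂ) (q : ℚ) : τ (algebraMap ℚ k q) = (q : ℂ) := by
  rw [eq_ratCast (algebraMap ℚ k), map_ratCast]

/-- **`N_{k/ℚ}(c) > 0` for `c ≠ 0`** in the imaginary-quadratic `k`: `N(c) = c σ(c)` and `τ(c σ(c)) = |τ c|²`. [folklore] -/
private theorem norm_pos_of_ne_zero (τ : k →+* ℂ) {c : k} (hc : c ≠ 0) : 0 < Algebra.norm ℚ c := by
  have h := congrArg τ (KR14dual.mul_conj_eq_norm c)
  rw [map_mul, embedding_conj, embedding_algebraMap, Complex.mul_conj] at h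
  have hτ : τ c ≠ 0 := (map_ne_zero τ).2 hc
  have hpos : (0 : ℝ) < Complex.normSq (τ c) := Complex.normSq_pos.2 hτ
  have h' : ((Complex.normSq (τ c) : ℝ) : ℂ) = ((Algebra.norm ℚ c : ℚ) : ℂ) := h
  have h'' : (Complex.normSq (τ c) : ℝ) = ((Algebra.norm ℚ c : ℚ) : ℝ) := by exact_mod_cast h'
  exact_mod_cast (h'' ▸ hpos)

omit [IsTotallyComplex k] [Algebra.IsQuadraticExtension ℚ k] in
/-- `N(𝔞) > 0` for an invertible fractional ideal. [folklore] -/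
private theorem absNorm_pos (𝔞 : (FractionalIdeal (𝓞 k)⁰ k)ˣ) :
    0 < FractionalIdeal.absNorm (𝔞 : FractionalIdeal (𝓞 k)⁰ k) :=
  lt_of_le_of_ne (FractionalIdeal.absNorm_nonneg _)
    (fun h => Units.ne_zero 𝔞 (FractionalIdeal.absNorm_eq_zero_iff.mp h.symm))

/-! ### (i) `L_{0,𝔞}` is a self-dual hermitian lattice of signature `(1, 0)` -/

/-- **Self-duality of `L_{0,𝔞}`** for `(x, y) = N(𝔞)⁻¹ x σ(y)`: `L_{0,𝔞}^∨ = L_{0,𝔞}` — `⊆` by (P1), `⊇` by (P2) and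
`(𝔞⁻¹)⁻¹ = 𝔞`. [cite: KudlaRapoport2013, §3.2 (3.1) (arXiv v2 p. 16)] [cite: NeukirchANT1999, Ch. I §2 Prop. (2.6) (iii)] -/
theorem idealLattice_isSelfDualFor (𝔞 : (FractionalIdeal (𝓞 k)⁰ k)ˣ) :
    IsSelfDualFor (conj ℚ k : k →+* k) (idealGram 𝔞) (idealLattice 𝔞) := by
  set N : ℚ := FractionalIdeal.absNorm (𝔞 : FractionalIdeal (𝓞 k)⁰ k) with hN
  have hN0 : N ≠ 0 := (absNorm_pos 𝔞).ne'
  have h𝔞0 : (𝔞 : FractionalIdeal (𝓞 k)⁰ k) ≠ 0 := Units.ne_zero 𝔞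
  intro x
  rw [mem_idealLattice_iff]
  constructor
  · intro hx y hy
    rw [mem_idealLattice_iff] at hy
    obtain ⟨o, ho⟩ := KR14dual.exists_int_eq_absNorm_inv_mul 𝔞 hy hx
    refine ⟨o, ?_⟩
    rw [krForm_fin_one, idealGram, Matrix.of_apply, map_inv₀]
    change (o : k) = _
    rw [ho]
    change (algebraMap ℚ k N)⁻¹ * conj ℚ k (y 0) * x 0 = conj ℚ k (y 0) * ((algebraMap ℚ k N)⁻¹ * x 0)
    ring
  · intro h
    -- `x₀ ∈ (𝔞⁻¹)⁻¹`
    rw [← inv_inv (𝔞 : FractionalIdeal (𝓞 k)⁰ k), FractionalIdeal.mem_inv_iff (inv_ne_zero h𝔞0)]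
    intro w hw
    have hy : (fun _ : Fin 1 => algebraMap ℚ k N * conj ℚ k w) ∈ idealLattice 𝔞 :=
      (const_mem_idealLattice_iff 𝔞 _).2 (KR14dual.absNorm_mul_conj_mem 𝔞 hw)
    obtain ⟨o, ho⟩ := h _ hy
    rw [krForm_fin_one, idealGram, Matrix.of_apply, map_inv₀] at ho
    change (o : k) = conj ℚ k (algebraMap ℚ k N * conj ℚ k w) * ((algebraMap ℚ k N)⁻¹ * x 0) at ho
    rw [map_mul, conj_conj', AlgEquiv.commutes] at ho
    have hNk : algebraMap ℚ k N ≠ 0 := (map_ne_zero_iff _ (algebraMap ℚ k).injective).2 hN0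
    refine (FractionalIdeal.mem_one_iff (𝓞 k)⁰).2 ⟨o, ?_⟩
    change (o : k) = x 0 * w
    rw [ho, mul_assoc, mul_left_comm w, mul_inv_cancel_left₀ hNk, mul_comm]

/-- **(i)** `(V_{0,𝔞}, L_{0,𝔞})` is a self-dual hermitian `O_k`-lattice of signature `(1, 0)` at every complex embedding `τ`:
`N(𝔞)⁻¹ ∈ ℚ_{>0}` is `σ`-fixed and `τ`-positive (`T = (√N(𝔞))` brings it to `(1)`), `𝔞` is finitely generated and spans `k`,
and `L_{0,𝔞}` is self-dual (`idealLattice_isSelfDualFor`). [cite: KudlaRapoport2013, §3.2 (3.1) (arXiv v2 p. 16)] -/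
theorem idealLatticeDatum_isSelfDualHermLattice (τ : k →+* ℂ) (𝔞 : (FractionalIdeal (𝓞 k)⁰ k)ˣ) :
    IsSelfDualHermLattice (conj ℚ k : k →+* k) τ 0 (idealLatticeDatum 𝔞) := by
  set N : ℚ := FractionalIdeal.absNorm (𝔞 : FractionalIdeal (𝓞 k)⁰ k) with hN
  have hNpos : 0 < N := absNorm_pos 𝔞
  have h𝔞0 : (𝔞 : FractionalIdeal (𝓞 k)⁰ k) ≠ 0 := Units.ne_zero 𝔞
  refine ⟨?_, ?_, ?_, idealLattice_isSelfDualFor 𝔞⟩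
  · -- hermitian
    intro i j
    rw [Subsingleton.elim i 0, Subsingleton.elim j 0]
    change conj ℚ k (idealGram 𝔞 0 0) = idealGram 𝔞 0 0
    rw [idealGram, Matrix.of_apply, AlgEquiv.commutes]
  · -- signature `(1, 0)` at `τ`
    have hs0 : ((Real.sqrt N : ℝ) : ℂ) ≠ 0 := by
      exact_mod_cast (Real.sqrt_pos.2 (by exact_mod_cast hNpos)).ne'
    refine ⟨Matrix.GeneralLinearGroup.mkOfDetNeZero !![((Real.sqrt N : ℝ) : ℂ)]
      (by rw [Matrix.det_fin_one_of]; exact hs0), ?_⟩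
    have hJ : ((idealLatticeDatum 𝔞).J).map τ = !![((N : ℝ) : ℂ)⁻¹] := by
      ext i j
      rw [Subsingleton.elim i 0, Subsingleton.elim j 0]
      change τ (idealGram 𝔞 0 0) = _
      rw [idealGram, Matrix.of_apply, ← hN, embedding_algebraMap, Rat.cast_inv]
      simp
    rw [hJ]
    change !![((Real.sqrt N : ℝ) : ℂ)]ᴴ * !![((N : ℝ) : ℂ)⁻¹] * !![((Real.sqrt N : ℝ) : ℂ)] = signDiag 1 0
    have hsq : ((Real.sqrt N : ℝ) : ℂ) * ((Real.sqrt N : ℝ) : ℂ) = ((N : ℝ) : ℂ) := by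
      rw [← Complex.ofReal_mul, Real.mul_self_sqrt (by exact_mod_cast hNpos.le)]
    have hN0 : ((N : ℝ) : ℂ) ≠ 0 := by exact_mod_cast hNpos.ne'
    ext i j
    rw [Subsingleton.elim i 0, Subsingleton.elim j 0]
    simp only [signDiag, Matrix.conjTranspose, Matrix.mul_apply, Fin.sum_univ_one, Matrix.transpose_apply,
      Matrix.map_apply, Matrix.of_apply, Matrix.cons_val', Matrix.cons_val_fin_one, Matrix.empty_val',
      Complex.star_def, Complex.conj_ofReal, Matrix.diagonal_apply_eq, Fin.val_zero, Nat.sub_zero,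
      Nat.lt_one_iff, if_true]
    field_simp
    rw [sq, hsq]
  · -- full lattice
    refine ⟨(FractionalIdeal.fg_unit 𝔞).map _, ?_⟩
    obtain ⟨a, ha0, ha⟩ := FractionalIdeal.exists_ne_zero_mem_isInteger h𝔞0
    have ha0' : (algebraMap (𝓞 k) k a) ≠ 0 :=
      (map_ne_zero_iff _ (FaithfulSMul.algebraMap_injective (𝓞 k) k)).2 ha0
    rw [Submodule.eq_top_iff']
    intro v
    have hv : v = (v 0 * (algebraMap (𝓞 k) k a)⁻¹) • (fun _ : Fin 1 => algebraMap (𝓞 k) k a) := by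
      funext i
      rw [Subsingleton.elim i 0, Pi.smul_apply, smul_eq_mul, inv_mul_cancel_right₀ ha0']
    rw [hv]
    exact Submodule.smul_mem _ _ (Submodule.subset_span ((const_mem_idealLattice_iff 𝔞 _).2 ha))


/-! ### More rank-one bookkeeping -/

/-- A vector of length one is constant. [folklore] -/
private theorem eq_const {α : Type*} (x : Fin 1 → α) : (fun _ : Fin 1 => x 0) = x := by
  funext i
  rw [Subsingleton.elim i 0]

/-- `(A B)₀₀ = A₀₀ B₀₀` for `1 × 1` matrices. [folklore] -/
private theorem mul_fin_one_apply {R : Type*} [NonUnitalNonAssocSemiring R] (A B : Matrix (Fin 1) (Fin 1) R) :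
    (A * B) 0 0 = A 0 0 * B 0 0 := by
  simp [Matrix.mul_apply]

omit [NumberField k] [IsTotallyComplex k] [Algebra.IsQuadraticExtension ℚ k] in
/-- `(M v)₀ = M₀₀ v₀` for `1 × 1` matrices. [folklore] -/
private theorem mulVec_fin_one_apply (M : Matrix (Fin 1) (Fin 1) k) (v : Fin 1 → k) : (M *ᵥ v) 0 = M 0 0 * v 0 := by
  simp [mulVec, dotProduct]

omit [NumberField k] [IsTotallyComplex k] [Algebra.IsQuadraticExtension ℚ k] in
/-- `z ∈ g L ⟺ z₀ = g₀₀ y₀` for some `y ∈ L`, in rank one. [folklore] -/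
private theorem mem_latticeImage_iff (g : GL (Fin 1) k) (L : Submodule (𝓞 k) (Fin 1 → k)) (z : Fin 1 → k) :
    z ∈ latticeImage g L ↔ ∃ y ∈ L, (g : Matrix (Fin 1) (Fin 1) k) 0 0 * y 0 = z 0 := by
  rw [latticeImage, Submodule.mem_map]
  constructor
  · rintro ⟨y, hy, hyz⟩
    refine ⟨y, hy, ?_⟩
    have h := congrFun hyz 0
    rwa [LinearMap.restrictScalars_apply, Matrix.toLin'_apply, mulVec_fin_one_apply] at h
  · rintro ⟨y, hy, h⟩
    refine ⟨y, hy, ?_⟩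
    rw [← eq_const (((Matrix.toLin' (g : Matrix (Fin 1) (Fin 1) k)).restrictScalars (𝓞 k)) y), ← eq_const z,
      LinearMap.restrictScalars_apply, Matrix.toLin'_apply, mulVec_fin_one_apply, h]

omit [NumberField k] [IsTotallyComplex k] [Algebra.IsQuadraticExtension ℚ k] in
/-- The `(0,0)` entry of `σ(g)ᵀ H g` in rank one. [folklore] -/
private theorem formCongr_fin_one_apply (σ : k →+* k) (g : GL (Fin 1) k) (H : Matrix (Fin 1) (Fin 1) k) :
    formCongr σ g H 0 0 = σ ((g : Matrix (Fin 1) (Fin 1) k) 0 0) * H 0 0 * (g : Matrix (Fin 1) (Fin 1) k) 0 0 := by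
  dsimp only [formCongr]
  rw [mul_fin_one_apply, mul_fin_one_apply, Matrix.transpose_apply, Matrix.map_apply]

omit [IsTotallyComplex k] [Algebra.IsQuadraticExtension ℚ k] in
/-- `L_{0,𝔟} = g L_{0,𝔞}` for `g = (c)` iff `𝔟 = c 𝔞`. [folklore] -/
private theorem idealLattice_eq_latticeImage_iff (g : GL (Fin 1) k) (𝔞 𝔟 : (FractionalIdeal (𝓞 k)⁰ k)ˣ) :
    idealLattice 𝔟 = latticeImage g (idealLattice 𝔞) ↔
      (𝔟 : FractionalIdeal (𝓞 k)⁰ k) =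
        FractionalIdeal.spanSingleton (𝓞 k)⁰ ((g : Matrix (Fin 1) (Fin 1) k) 0 0) * 𝔞 := by
  constructor
  · intro hL
    ext z
    rw [FractionalIdeal.mem_singleton_mul, ← const_mem_idealLattice_iff 𝔟, hL, mem_latticeImage_iff]
    constructor
    · rintro ⟨y, hy, h⟩
      exact ⟨y 0, (mem_idealLattice_iff 𝔞 y).1 hy, h.symm⟩
    · rintro ⟨a, ha, h⟩
      exact ⟨fun _ => a, (const_mem_idealLattice_iff 𝔞 a).2 ha, h.symm⟩
  · intro h𝔟
    ext z
    rw [mem_idealLattice_iff, h𝔟, FractionalIdeal.mem_singleton_mul, mem_latticeImage_iff]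
    constructor
    · rintro ⟨a, ha, h⟩
      exact ⟨fun _ => a, (const_mem_idealLattice_iff 𝔞 a).2 ha, h.symm⟩
    · rintro ⟨y, hy, h⟩
      exact ⟨y 0, (mem_idealLattice_iff 𝔞 y).1 hy, h.symm⟩

/-! ### (ii) `L_{0,𝔞} ≅ L_{0,𝔟} ⟺ [𝔞] = [𝔟]` -/

omit [IsTotallyComplex k] [Algebra.IsQuadraticExtension ℚ k] in
/-- `[𝔞] = [𝔟]` in `C(k)` iff `𝔟 = c 𝔞` for some `c ∈ k` (Mathlib `ClassGroup.mk_eq_one_iff` on `𝔞⁻¹𝔟`). [cite: NeukirchANT1999, Ch. I §6 (ideal class group)] -/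
theorem classGroup_mk_eq_mk_iff_exists (𝔞 𝔟 : (FractionalIdeal (𝓞 k)⁰ k)ˣ) :
    ClassGroup.mk k 𝔞 = ClassGroup.mk k 𝔟 ↔
      ∃ c : k, (𝔟 : FractionalIdeal (𝓞 k)⁰ k) = FractionalIdeal.spanSingleton (𝓞 k)⁰ c * 𝔞 := by
  have h𝔞0 : (𝔞 : FractionalIdeal (𝓞 k)⁰ k) ≠ 0 := Units.ne_zero 𝔞
  rw [← inv_mul_eq_one, ← map_inv, ← map_mul, ClassGroup.mk_eq_one_iff, FractionalIdeal.isPrincipal_iff]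
  constructor
  · rintro ⟨c, hc⟩
    refine ⟨c, ?_⟩
    rw [Units.val_mul, Units.val_inv_eq_inv_val] at hc
    calc (𝔟 : FractionalIdeal (𝓞 k)⁰ k)
        = 𝔞 * ((𝔞 : FractionalIdeal (𝓞 k)⁰ k)⁻¹ * 𝔟) := by rw [← mul_assoc, mul_inv_cancel₀ h𝔞0, one_mul]
      _ = FractionalIdeal.spanSingleton (𝓞 k)⁰ c * 𝔞 := by rw [hc, mul_comm]
  · rintro ⟨c, hc⟩
    refine ⟨c, ?_⟩
    rw [Units.val_mul, Units.val_inv_eq_inv_val, hc, mul_comm, mul_assoc, mul_inv_cancel₀ h𝔞0, mul_one]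

/-- **(ii)** `L_{0,𝔞} ≅ L_{0,𝔟}` (an isometry `g ∈ GL₁(k)` with `g L_{0,𝔞} = L_{0,𝔟}`) iff `[𝔞] = [𝔟]` in `C(k)`: `g = (c)`
moves the lattice iff `𝔟 = c𝔞`, and then the forms agree automatically, `σ(c) N(c𝔞)⁻¹ c = N(𝔞)⁻¹`, because
`N(c𝔞) = |N(c)| N(𝔞)` and `N(c) = c σ(c) > 0`. [cite: KudlaRapoport2013, §3.2 (3.1) (arXiv v2 p. 16)] -/
theorem exists_moves_idealLatticeDatum_iff (τ : k →+* ℂ) (𝔞 𝔟 : (FractionalIdeal (𝓞 k)⁰ k)ˣ) :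
    (∃ g : GL (Fin 1) k, LatticeDatum.Moves g (idealLatticeDatum 𝔞) (idealLatticeDatum 𝔟)) ↔
      ClassGroup.mk k 𝔞 = ClassGroup.mk k 𝔟 := by
  rw [classGroup_mk_eq_mk_iff_exists]
  constructor
  · rintro ⟨g, -, hL⟩
    exact ⟨_, (idealLattice_eq_latticeImage_iff g 𝔞 𝔟).1 hL⟩
  · rintro ⟨c, hc⟩
    have hc0 : c ≠ 0 := by
      rintro rfl
      rw [FractionalIdeal.spanSingleton_zero, zero_mul] at hc
      exact Units.ne_zero 𝔟 hc
    set g : GL (Fin 1) k := Matrix.GeneralLinearGroup.mkOfDetNeZero !![c]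
      (by rw [Matrix.det_fin_one_of]; exact hc0) with hg
    have hg00 : (g : Matrix (Fin 1) (Fin 1) k) 0 0 = c := rfl
    refine ⟨g, ?_, (idealLattice_eq_latticeImage_iff g 𝔞 𝔟).2 (by rw [hg00]; exact hc)⟩
    -- the forms: `σ(c) N(𝔟)⁻¹ c = N(𝔞)⁻¹`
    have hN : FractionalIdeal.absNorm (𝔟 : FractionalIdeal (𝓞 k)⁰ k) =
        Algebra.norm ℚ c * FractionalIdeal.absNorm (𝔞 : FractionalIdeal (𝓞 k)⁰ k) := by
      rw [hc, map_mul, FractionalIdeal.absNorm_span_singleton, abs_of_pos (norm_pos_of_ne_zero τ hc0)]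
    have hNc : Algebra.norm ℚ c ≠ 0 := (norm_pos_of_ne_zero τ hc0).ne'
    have hN𝔞 : FractionalIdeal.absNorm (𝔞 : FractionalIdeal (𝓞 k)⁰ k) ≠ 0 := (absNorm_pos 𝔞).ne'
    ext i j
    rw [Subsingleton.elim i 0, Subsingleton.elim j 0]
    change formCongr (conj ℚ k : k →+* k) g (idealGram 𝔟) 0 0 = idealGram 𝔞 0 0
    rw [formCongr_fin_one_apply, hg00, idealGram, idealGram, Matrix.of_apply, Matrix.of_apply, hN]
    change conj ℚ k c *
        algebraMap ℚ k (Algebra.norm ℚ c * FractionalIdeal.absNorm (𝔞 : FractionalIdeal (𝓞 k)⁰ k))⁻¹ * c =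
      algebraMap ℚ k (FractionalIdeal.absNorm (𝔞 : FractionalIdeal (𝓞 k)⁰ k))⁻¹
    calc conj ℚ k c *
          algebraMap ℚ k (Algebra.norm ℚ c * FractionalIdeal.absNorm (𝔞 : FractionalIdeal (𝓞 k)⁰ k))⁻¹ * c
        = c * conj ℚ k c *
          algebraMap ℚ k (Algebra.norm ℚ c * FractionalIdeal.absNorm (𝔞 : FractionalIdeal (𝓞 k)⁰ k))⁻¹ := by
          ring
      _ = algebraMap ℚ k (Algebra.norm ℚ c *
          (Algebra.norm ℚ c * FractionalIdeal.absNorm (𝔞 : FractionalIdeal (𝓞 k)⁰ k))⁻¹) := by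
          rw [KR14dual.mul_conj_eq_norm, ← map_mul]
      _ = algebraMap ℚ k (FractionalIdeal.absNorm (𝔞 : FractionalIdeal (𝓞 k)⁰ k))⁻¹ := by
          congr 1
          field_simp

/-! ### (iii) every self-dual rank-one lattice of signature `(1, 0)` is an `L_{0,𝔞}` -/

/-- **(iii)** A self-dual hermitian `O_k`-lattice `(j, L)` of rank `1` and signature `(1,0)` IS `(V_{0,𝔞}, L_{0,𝔞})` for the
fractional ideal `𝔞 = L ⊆ k` (and `g = 1`): comparing the self-duality of `(j, L)` with that of `L_{0,𝔞}` gives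
`x ∈ 𝔞 ⟺ jN(𝔞)x ∈ 𝔞`, so `u = jN(𝔞)` is a unit of `O_k` with `u σ(u) = ±1`; the signature makes `τ(u) > 0` real, hence
`|τ u|² = 1` forces `τ u = 1`, `u = 1`, `j = N(𝔞)⁻¹`. [cite: KudlaRapoport2013, §3.2 (3.1) (arXiv v2 p. 16)] -/
theorem exists_moves_idealLatticeDatum_of_isSelfDualHermLattice (τ : k →+* ℂ) (X : LatticeDatum k 1)
    (hX : IsSelfDualHermLattice (conj ℚ k : k →+* k) τ 0 X) :
    ∃ (𝔞 : (FractionalIdeal (𝓞 k)⁰ k)ˣ) (g : GL (Fin 1) k), LatticeDatum.Moves g X (idealLatticeDatum 𝔞) := by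
  classical
  obtain ⟨-, ⟨T, hT⟩, ⟨hfg, hspan⟩, hdual⟩ := hX
  -- the fractional ideal `𝔞 = {x₀ : x ∈ L}`
  set L₀ : Submodule (𝓞 k) k :=
    X.L.map ((LinearEquiv.funUnique (Fin 1) (𝓞 k) k : (Fin 1 → k) ≃ₗ[𝓞 k] k) : (Fin 1 → k) →ₗ[𝓞 k] k) with hL₀
  have hmemL₀ : ∀ a : k, a ∈ L₀ ↔ (fun _ : Fin 1 => a) ∈ X.L := by
    intro a
    rw [hL₀, Submodule.mem_map_equiv]
    rfl
  have hXL : ∀ x : Fin 1 → k, x ∈ X.L ↔ x 0 ∈ L₀ := by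
    intro x
    rw [hmemL₀, eq_const x]
  have hfrac : IsFractional (𝓞 k)⁰ L₀ := FractionalIdeal.isFractional_of_fg (hfg.map _)
  set I : FractionalIdeal (𝓞 k)⁰ k := ⟨L₀, hfrac⟩ with hI
  have hmemI : ∀ a : k, a ∈ I ↔ (fun _ : Fin 1 => a) ∈ X.L := hmemL₀
  have hI0 : I ≠ 0 := by
    intro h0
    have hL : X.L = ⊥ := by
      rw [Submodule.eq_bot_iff]
      intro x hx
      have hx0 : x 0 ∈ I := (hXL x).1 hx
      rw [h0, FractionalIdeal.mem_zero_iff] at hx0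
      rw [← eq_const x, hx0]
      rfl
    have h1 : (fun _ : Fin 1 => (1 : k)) ∈ Submodule.span k (X.L : Set (Fin 1 → k)) := by
      rw [hspan]
      exact Submodule.mem_top
    rw [hL, Submodule.bot_coe, Submodule.span_zero_singleton, Submodule.mem_bot] at h1
    exact one_ne_zero (congrFun h1 0)
  set 𝔞 : (FractionalIdeal (𝓞 k)⁰ k)ˣ := Units.mk0 I hI0 with h𝔞
  have h𝔞I : (𝔞 : FractionalIdeal (𝓞 k)⁰ k) = I := rfl
  have hmem𝔞 : ∀ x : Fin 1 → k, x ∈ X.L ↔ x ∈ idealLattice 𝔞 := by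
    intro x
    rw [mem_idealLattice_iff, h𝔞I, hXL]
    rfl
  -- notation
  set j : k := X.J 0 0 with hj
  set N : ℚ := FractionalIdeal.absNorm (𝔞 : FractionalIdeal (𝓞 k)⁰ k) with hN
  have hNpos : 0 < N := absNorm_pos 𝔞
  have hNk : algebraMap ℚ k N ≠ 0 := (map_ne_zero_iff _ (algebraMap ℚ k).injective).2 hNpos.ne'
  -- the signature: `τ j · |t|² = 1`
  set t : ℂ := (T : Matrix (Fin 1) (Fin 1) ℂ) 0 0 with ht
  have hsig : starRingEnd ℂ t * τ j * t = 1 := by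
    have h := congrFun (congrFun hT 0) 0
    rw [mul_fin_one_apply, mul_fin_one_apply, Matrix.conjTranspose_apply, Matrix.map_apply, ← ht, ← hj,
      Complex.star_def] at h
    rw [h]
    simp [signDiag]
  have ht0 : Complex.normSq t ≠ 0 := by
    intro h0
    rw [Complex.normSq_eq_zero] at h0
    rw [h0, mul_zero] at hsig
    exact zero_ne_one hsig
  have hτj : τ j = ((Complex.normSq t : ℝ) : ℂ)⁻¹ := by
    refine eq_inv_of_mul_eq_one_left ?_
    rw [← Complex.mul_conj, ← hsig]
    ring
  have hj0 : j ≠ 0 := by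
    intro h0
    rw [h0, map_zero, mul_zero, zero_mul] at hsig
    exact zero_ne_one hsig
  -- `r = j N(𝔞)` multiplies `𝔞` onto itself
  set r : k := j * algebraMap ℚ k N with hr
  have hr0 : r ≠ 0 := mul_ne_zero hj0 hNk
  have hdual𝔞 := idealLattice_isSelfDualFor 𝔞
  have hra : ∀ a : k, a ∈ I ↔ r * a ∈ I := by
    intro a
    have h1 : a ∈ I ↔ ∀ b ∈ I, conj ℚ k b * (j * a) ∈ (algebraMap (𝓞 k) k).range := by
      rw [hmemI, hdual]
      constructor
      · intro h b hb
        have h' := h _ ((hmemI b).1 hb)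
        rwa [krForm_fin_one] at h'
      · intro h y hy
        rw [krForm_fin_one]
        exact h _ ((hmemI _).2 (by rw [eq_const y]; exact hy))
    have h2 : r * a ∈ I ↔ ∀ b ∈ I, conj ℚ k b * (j * a) ∈ (algebraMap (𝓞 k) k).range := by
      rw [← h𝔞I, ← const_mem_idealLattice_iff 𝔞, hdual𝔞]
      constructor
      · intro h b hb
        have h' := h _ ((const_mem_idealLattice_iff 𝔞 b).2 (h𝔞I ▸ hb))
        rw [krForm_fin_one, idealGram, Matrix.of_apply, ← hN, map_inv₀] at h'
        change conj ℚ k b * ((algebraMap ℚ k N)⁻¹ * (r * a)) ∈ _ at h'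
        rwa [hr, mul_comm j, mul_assoc (algebraMap ℚ k N), inv_mul_cancel_left₀ hNk] at h'
      · intro h y hy
        rw [krForm_fin_one, idealGram, Matrix.of_apply, ← hN, map_inv₀]
        change conj ℚ k (y 0) * ((algebraMap ℚ k N)⁻¹ * (r * a)) ∈ _
        rw [hr, mul_comm j, mul_assoc (algebraMap ℚ k N), inv_mul_cancel_left₀ hNk]
        exact h _ (h𝔞I ▸ (mem_idealLattice_iff 𝔞 y).1 hy)
    rw [h1, h2]
  have hspanr : FractionalIdeal.spanSingleton (𝓞 k)⁰ r * I = I := by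
    ext z
    rw [FractionalIdeal.mem_singleton_mul]
    constructor
    · rintro ⟨a, ha, rfl⟩
      exact (hra a).1 ha
    · intro hz
      exact ⟨r⁻¹ * z, (hra _).2 (by rwa [mul_inv_cancel_left₀ hr0]), by rw [mul_inv_cancel_left₀ hr0]⟩
  have hr1 : FractionalIdeal.spanSingleton (𝓞 k)⁰ r = 1 := (mul_eq_right₀ hI0).1 hspanr
  -- so `r` is a unit of `O_k`
  obtain ⟨u, hu⟩ := (FractionalIdeal.mem_one_iff (𝓞 k)⁰).1
    (hr1 ▸ FractionalIdeal.mem_spanSingleton_self (𝓞 k)⁰ r)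
  obtain ⟨v, hv⟩ := (FractionalIdeal.mem_spanSingleton (𝓞 k)⁰).1
    (hr1.symm ▸ FractionalIdeal.one_mem_one (𝓞 k)⁰ : (1 : k) ∈ FractionalIdeal.spanSingleton (𝓞 k)⁰ r)
  have huv : v * u = 1 := by
    apply FaithfulSMul.algebraMap_injective (𝓞 k) k
    rw [map_mul, hu, map_one, ← hv, Algebra.smul_def]
  have hunit : IsUnit u := isUnit_iff_exists_inv.2 ⟨v, by rw [mul_comm]; exact huv⟩
  have hnorm : |Algebra.norm ℚ r| = 1 := by
    have h := NumberField.Units.norm k hunit.unit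
    rw [IsUnit.unit_spec] at h
    change |Algebra.norm ℚ (algebraMap (𝓞 k) k u)| = 1 at h
    rwa [hu] at h
  -- `τ r` is a positive real of absolute value one
  set ρ : ℝ := (Complex.normSq t)⁻¹ * N with hρ
  have hρpos : 0 < ρ := mul_pos (inv_pos.2 (lt_of_le_of_ne (Complex.normSq_nonneg t) (Ne.symm ht0))) (by exact_mod_cast hNpos)
  have hτr : τ r = (ρ : ℂ) := by
    rw [hr, map_mul, hτj, embedding_algebraMap, hρ]
    push_cast
    ring
  have hρsq : ρ ^ 2 = Algebra.norm ℚ r := by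
    have h := congrArg τ (KR14dual.mul_conj_eq_norm r)
    rw [map_mul, embedding_conj, embedding_algebraMap, hτr, Complex.conj_ofReal, ← Complex.ofReal_mul,
      ← sq] at h
    exact_mod_cast h
  have hρ1 : ρ = 1 := by
    have hsq1 : ρ ^ 2 = 1 := by
      rcases abs_eq (zero_le_one) |>.1 hnorm with h | h
      · rw [hρsq, h]; norm_num
      · exfalso
        have : (0 : ℝ) < ρ ^ 2 := by positivity
        rw [hρsq, h] at this
        norm_num at this
    nlinarith [hsq1, hρpos]
  have hr1' : r = 1 := τ.injective (by rw [hτr, hρ1, map_one]; norm_num)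
  have hjN : j = algebraMap ℚ k N⁻¹ := by
    rw [map_inv₀]
    refine eq_inv_of_mul_eq_one_left ?_
    rw [← hr, hr1']
  -- assemble: `X = L_{0,𝔞}` on the nose
  refine ⟨𝔞, 1, ?_, ?_⟩
  · ext i i'
    rw [Subsingleton.elim i 0, Subsingleton.elim i' 0]
    change formCongr (conj ℚ k : k →+* k) 1 (idealGram 𝔞) 0 0 = X.J 0 0
    rw [formCongr_fin_one_apply, Units.val_one, Matrix.one_apply_eq, map_one, one_mul, mul_one, idealGram,
      Matrix.of_apply, ← hN, ← hjN]
  · ext z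
    change z ∈ idealLattice 𝔞 ↔ z ∈ latticeImage 1 X.L
    rw [← hmem𝔞, mem_latticeImage_iff, Units.val_one]
    constructor
    · intro hz
      exact ⟨z, hz, by rw [Matrix.one_apply_eq, one_mul]⟩
    · rintro ⟨y, hy, h⟩
      rw [Matrix.one_apply_eq, one_mul] at h
      rwa [← eq_const z, ← h, eq_const y]

/-! ### Assembly -/

/-- ★ `KR2013_3_eq_3_1` HOLDS. [KudlaRapoport2013, §3.2 (3.1) (arXiv v2 p. 16)]: «A fractional ideal `𝔞` defines a self-dual
hermitian lattice `L_{0,𝔞}` in the space `V_{0,𝔞} = k` with hermitian form `(x, y) = N(𝔞)⁻¹ x y^σ`. This gives an isomorphism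
`C(k) ≅ 𝓛_{(1,0)}(k)`, `[𝔞] ↦ [L_{0,𝔞}]`» — (i) `idealLatticeDatum_isSelfDualHermLattice`, (ii)
`exists_moves_idealLatticeDatum_iff`, (iii) `exists_moves_idealLatticeDatum_of_isSelfDualHermLattice`.
[cite: KudlaRapoport2013, §3.2 (3.1) (arXiv v2 p. 16)] [cite: NeukirchANT1999, Ch. I §2 Prop. (2.6) (iii)] -/
theorem KR2013_3_eq_3_1_holds : KR2013_3_eq_3_1 := by
  intro k _ _ _ _ τ
  exact ⟨idealLatticeDatum_isSelfDualHermLattice τ, exists_moves_idealLatticeDatum_iff τ,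
    exists_moves_idealLatticeDatum_of_isSelfDualHermLattice τ⟩

end Literature.AlgebraicGeometry.ShimuraVarieties.KudlaRapoport2013.Sec3ComplexUniformization

end
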